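import Summits.Ventures.PercRepro.S1TriangleBoundEight

/-!
# PercRepro — THE (C3)-REFINED TRIANGLE BOUND `triBound8C`: p8's refined bootstrap `triBound8` with the rank-`4`
bound used at EVERY `m ≥ 3` once the nullity is `≥ 7` (p9, gen 29; S4 — the row `37` of the `q = 7` window)

S1TriangleBoundEight / S1TriangleCountBootEight (p8 g23): at the point `x` on the fewest triangles (`m := t_x`) of a
matroid of nullity `ν = d + 1`, with `F` the bound at nullity `d`, either the restriction `M ↾ U` to `U = ⋃ triangles`
has smaller nullity or `|U| = r(U) + ν`; `r(U) ≥ 4` once `|U| ≥ 7` (C2) and `r(U) ≥ 5` once `|U| ≥ 11` (C3). p8's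
`StepOK` triggers (C3) from the star `|U| ≥ 2m + 1 ≥ 11`, i.e. for `m ≥ 5` only. THE REFINEMENT: for `3 ≤ m` the
bound `|U| ≥ r(U) + ν ≥ 4 + ν` already gives `|U| ≥ 11` as soon as `ν ≥ 7` (`d ≥ 6`), so (C3) applies and the
restriction constraint is `(d + 3)·m ≤ 3F` for EVERY `m ≥ 3` at `d ≥ 6`. **`StepOKC d F m`** = `StepOK d F m` plus
that clause; **`stepRC`** / **`triBound8C`** the corresponding step and recursion (the same base `0, 1, 2, 4, 6, 8`, the
kernels at nullities `4` and `5`): `0, 1, 2, 4, 6, 8, 11, 14, 18, 22, 27, 33, 40, 48, 57, 66, 76, 87, …` — `18` against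
`19` at `ν = 8` (`stepRC 6 11 = 3`: `m = 4` fails `9·4 ≤ 33`; `stepRC 7 14 = 4`: `m = 5` fails `10·5 ≤ 42`), which is
what the cell `(37, 8)` of level `7` needs beside `s₅ ≤ 702`. Here the definitions, the recursion (`triBound8C_succ`),
the two halves of the value of `stepRC` (`le_stepRC_of`, `stepRC_eq_of` — the step `t + 1` violates the star constraint,
the restriction constraint in one of p8's two forms, or the refined constraint), the step of the values
(`triBound8C_succ_eq`), monotonicity, `triBound8C = triBound8` for `d ≤ 5`, and the values `d ≤ 8`. The count
`s₃ ≤ triBound8C ν` under (C1), (C2), (C3) is S1TriangleCountBootEightC. Axioms: standard.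
-/

namespace PercRepro

namespace S1

/-- The (C3)-refined step predicate at nullity `d + 1` from the bound `F` at nullity `d`: p8's `StepOK d F m` (the star
constraint `2m² ≤ 2m + 3F` and the restriction constraint in its `m ≤ 4` / `m ≥ 5` forms) together with the refined
restriction constraint `(d + 3)·m ≤ 3F` for every `m ≥ 3` once `d ≥ 6`. -/
abbrev StepOKC (d F m : ℕ) : Prop :=
  StepOK d F m ∧ (3 ≤ m → 6 ≤ d → (d + 3) * m ≤ 3 * F)

/-- **The refined step**: the largest `m ≤ 3F + 2` with `StepOKC d F m`. -/
def stepRC (d F : ℕ) : ℕ := Nat.findGreatest (StepOKC d F) (3 * F + 2)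

/-- **The (C3)-refined bootstrap**: `triBound8C ν = triBound8 ν` for `ν ≤ 5` (the kernels at nullities `4` and `5`), and
`triBound8C (ν + 1) = triBound8C ν + stepRC ν (triBound8C ν)` from `ν = 5` on. -/
def triBound8C : ℕ → ℕ
  | 0 => 0
  | 1 => 1
  | 2 => 2
  | 3 => 4
  | 4 => 6
  | 5 => 8
  | d + 6 => triBound8C (d + 5) + stepRC (d + 5) (triBound8C (d + 5))

/-- The recursion of `triBound8C` from `ν = 5` on. -/
theorem triBound8C_succ (d : ℕ) (hd : 5 ≤ d) :
    triBound8C (d + 1) = triBound8C d + stepRC d (triBound8C d) := by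
  obtain ⟨k, rfl⟩ := Nat.exists_eq_add_of_le hd
  rw [show 5 + k + 1 = k + 6 by omega, show 5 + k = k + 5 by omega]
  rfl

/-- The search bound of `stepRC` is safe: `StepOKC d F m` forces `m ≤ 3F + 2`. -/
theorem le_of_stepOKC {d F m : ℕ} (h : StepOKC d F m) : m ≤ 3 * F + 2 :=
  le_of_stepOK h.1

/-- **The lower half**: an allowed `m` is at most `stepRC d F`. -/
theorem le_stepRC_of {d F m : ℕ} (h : StepOKC d F m) : m ≤ stepRC d F :=
  Nat.le_findGreatest (le_of_stepOKC h) h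

/-- **The value of `stepRC`**: if `StepOKC d F t` with `2 ≤ t`, and the step `t + 1` violates the star constraint, the
restriction constraint (in its `m ≤ 4` form, or for `t ≥ 4` its `m ≥ 5` form), or the refined constraint (`6 ≤ d`), then
`stepRC d F = t`. -/
theorem stepRC_eq_of {d F t : ℕ} (ht : 2 ≤ t) (h1 : StepOKC d F t)
    (h2 : 2 * (t + 1) + 3 * F < 2 * (t + 1) * (t + 1) ∨ 3 * F < (d + 2) * (t + 1) ∨
      (4 ≤ t ∧ 3 * F < (d + 3) * (t + 1)) ∨ (6 ≤ d ∧ 3 * F < (d + 3) * (t + 1))) : stepRC d F = t := by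
  unfold stepRC
  rw [Nat.findGreatest_eq_iff]
  refine ⟨le_of_stepOKC h1, fun _ => h1, fun n hn _ hP => ?_⟩
  obtain ⟨⟨hPa, hPb⟩, hPc⟩ := hP
  rcases h2 with h2 | h2 | ⟨ht4, h2⟩ | ⟨hd6, h2⟩
  · have hmono : 2 * (t + 1) * (t + 1) ≤ 2 * (t + 1) + 3 * F := by nlinarith [hPa, hn]
    omega
  · rcases hPb with h | ⟨-, -, h⟩ | ⟨-, h⟩
    · omega
    · have : (d + 2) * (t + 1) ≤ (d + 2) * n := Nat.mul_le_mul_left (d + 2) hn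
      omega
    · have : (d + 2) * (t + 1) ≤ (d + 3) * n := by nlinarith [hn]
      omega
  · rcases hPb with h | ⟨-, h4, -⟩ | ⟨-, h⟩
    · omega
    · omega
    · have : (d + 3) * (t + 1) ≤ (d + 3) * n := Nat.mul_le_mul_left (d + 3) hn
      omega
  · have h3 : (d + 3) * n ≤ 3 * F := hPc (by omega) hd6
    have : (d + 3) * (t + 1) ≤ (d + 3) * n := Nat.mul_le_mul_left (d + 3) hn
    omega

/-- **The step of the values**: for `5 ≤ d`, if `triBound8C d = F`, `StepOKC d F t` with `2 ≤ t`, and `t + 1` violates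
one of the constraints, then `triBound8C (d + 1) = F + t`. -/
theorem triBound8C_succ_eq {d F t : ℕ} (hd : 5 ≤ d) (hF : triBound8C d = F) (ht : 2 ≤ t) (h1 : StepOKC d F t)
    (h2 : 2 * (t + 1) + 3 * F < 2 * (t + 1) * (t + 1) ∨ 3 * F < (d + 2) * (t + 1) ∨
      (4 ≤ t ∧ 3 * F < (d + 3) * (t + 1)) ∨ (6 ≤ d ∧ 3 * F < (d + 3) * (t + 1))) :
    triBound8C (d + 1) = F + t := by
  rw [triBound8C_succ d hd, hF, stepRC_eq_of ht h1 h2]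

/-- `triBound8C` never decreases. -/
theorem triBound8C_le_succ (d : ℕ) : triBound8C d ≤ triBound8C (d + 1) := by
  rcases Nat.lt_or_ge d 5 with h | h
  · interval_cases d <;> decide
  · rw [triBound8C_succ d h]
    exact Nat.le_add_right _ _

/-- `triBound8C` is monotone. -/
theorem triBound8C_mono {d d' : ℕ} (h : d ≤ d') : triBound8C d ≤ triBound8C d' :=
  monotone_nat_of_le_succ triBound8C_le_succ h

/-- `triBound8C d = triBound8 d` for `d ≤ 5`. -/
theorem triBound8C_eq_triBound8_of_le_five {d : ℕ} (hd : d ≤ 5) : triBound8C d = triBound8 d := by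
  interval_cases d <;> rfl

/-- `triBound8C d = triBound6 d` for `d ≤ 4`. -/
theorem triBound8C_eq_triBound6_of_le_four {d : ℕ} (hd : d ≤ 4) : triBound8C d = triBound6 d := by
  interval_cases d <;> rfl

/-- `triBound8C 0 = 0`. -/
theorem triBound8C_val_0 : triBound8C 0 = 0 := rfl

/-- `triBound8C 1 = 1`. -/
theorem triBound8C_val_1 : triBound8C 1 = 1 := rfl

/-- `triBound8C 2 = 2`. -/
theorem triBound8C_val_2 : triBound8C 2 = 2 := rfl

/-- `triBound8C 3 = 4`. -/
theorem triBound8C_val_3 : triBound8C 3 = 4 := rfl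

/-- `triBound8C 4 = 6`. -/
theorem triBound8C_val_4 : triBound8C 4 = 6 := rfl

/-- `triBound8C 5 = 8`. -/
theorem triBound8C_val_5 : triBound8C 5 = 8 := rfl

/-- `triBound8C 6 = 11` (`stepRC 5 8 = 3`: `m = 4` fails `7·4 ≤ 24`; the refined clause is idle at `d = 5`). -/
theorem triBound8C_val_6 : triBound8C 6 = 11 :=
  triBound8C_succ_eq (t := 3) (by norm_num) triBound8C_val_5 (by norm_num) (by decide)
    (Or.inr (Or.inl (by norm_num)))

/-- `triBound8C 7 = 14` (`stepRC 6 11 = 3`: `m = 4` fails the refined constraint `9·4 ≤ 33` — p8's `stepR 6 11 = 4`). -/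
theorem triBound8C_val_7 : triBound8C 7 = 14 :=
  triBound8C_succ_eq (t := 3) (by norm_num) triBound8C_val_6 (by norm_num) (by decide)
    (Or.inr (Or.inr (Or.inr ⟨by norm_num, by norm_num⟩)))

/-- `triBound8C 8 = 18` (`stepRC 7 14 = 4`: `m = 5` fails `10·5 ≤ 42` — p8's `triBound8 8 = 19`). -/
theorem triBound8C_val_8 : triBound8C 8 = 18 :=
  triBound8C_succ_eq (t := 4) (by norm_num) triBound8C_val_7 (by norm_num) (by decide)
    (Or.inr (Or.inr (Or.inl ⟨by norm_num, by norm_num⟩)))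

/-- `triBound8C ≤ triBound8` at `d ≤ 8` (the refinement never loses). -/
theorem triBound8C_le_triBound8_of_le_eight {d : ℕ} (hd : d ≤ 8) : triBound8C d ≤ triBound8 d := by
  interval_cases d
  · rfl
  · rfl
  · rfl
  · rfl
  · rfl
  · rfl
  · rw [triBound8C_val_6, triBound8_val_6]
  · rw [triBound8C_val_7, triBound8_val_7]; norm_num
  · rw [triBound8C_val_8, triBound8_val_8]; norm_num

end S1

end PercRepro
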